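import Summits.HubbardSuperconductivity.HubbardSuperconductivity.Theorems.LogColdTorusLogColdXYCalibration
import Literature.MathematicalPhysics.QuantumLattice.XYOrderThermalProofs

/-!
# Route `LogColdTorus`, support `LogColdQuantumXYCalibration` (item `stmt-HubbardSuperconductivity-8811`)

QUANTUM CALIBRATION (hard-core lattice bosons / quantum XY, the `U(1)` class of pair condensates):
for every spin `S = n/2 ≥ 1/2` there is `κ₀` such that for all `κ ≥ κ₀` the Gibbs states of the
ferromagnetic quantum XY model `xyTorus 2 L n` at the LOGARITHMIC inverse temperature
`β_L = κ log L` have long-range order along even tori (`HasEvenTorusLRO` of the log-cold kernel).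

Proof = the tree's PROVED thermal Kennedy–Lieb–Shastry assembly one dimension down. All
model-dependent inputs of `XYOrderThermalProofs` hold for `d ≥ 1` at every `β > 0`:
Gaussian domination / infrared bound `xy_infraredBound_thermal`, Kubo `xy_kubo_thermal`, the sum
rule `sum_xy_structureFactor_mul_torusCosSum`, the bond-energy lower bound
`xy_pairCorr_lower_thermal`, assembled into [KLS1988PRL] eq. (7) by `kls_thermal_ineq7`:
`e₁ ≤ |Λ|⁻¹g₀ + ½√e₁ R_L + T_L/(2β)`. In `d = 2` the thermal term `T_L = torusGreen 0` is not
bounded but `≤ 2 log L` (`inv_sq_mul_sum_inv_dispersion_le` of the sibling module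
`LogColdTorusLogColdXYCalibration`), so along `β_L = κ log L` it costs `≤ 1/κ`, while the entropy
term `log(n+1)/(4β_L)` only improves; the endgame `kls_logCold_margin` is `kls_thermal_margin`
with `𝒯/(2β)` replaced by `1/κ`, giving `κ₀ = 16ℓ + 1 + 4(ℓ+1)/c`, `ℓ = log(n+1)/4`,
`c = 2(s - ½√s ρ) > 0`, `s = S²/2`, `ρ < 1/√2` the eventual bound on the KLS Riemann sums
(`klsRiemannSum_eventually_le`, `d ≥ 2`).

Sources: T. Kennedy, E. H. Lieb, B. S. Shastry, PRL 61 (1988) 2582, Theorem and eqs. (3)–(8);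
F. J. Dyson, E. H. Lieb, B. Simon, J. Stat. Phys. 18 (1978) 335, Thms. 4.2, 5.1; K. Kubo, PRL 61
(1988) 110; H. Tasaki, *Physics and Mathematics of Quantum Many-Body Systems* (2020), §4.
-/

set_option linter.dupNamespace false

noncomputable section

namespace Summit.HubbardSuperconductivity.HubbardSuperconductivity.Theorems.LogColdTorus

open Filter Topology Matrix Finset
open Literature.MathematicalPhysics.QuantumLattice Literature.Probability.LatticeModels
  Literature.MathematicalPhysics.QuantumLattice.XYOrderProofs
  Literature.Barriers.AtomisticToContinuum.BoseGas
open Summit.HubbardSuperconductivity.HubbardSuperconductivity.Theses.LogColdTorus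


section LogCold

/-- **The thermal term of [KLS1988PRL] eq. (7) in two dimensions is a logarithm**: on the even
torus `(ℤ/Lℤ)²`, `L ≥ 4`, `T_L = torusGreen 0 = L⁻² Σ_{p≠0} E_p⁻¹ ≤ 2 log L`
(`inv_sq_mul_sum_inv_dispersion_le`). [cite: KLS1988PRL, eq. (7)] -/
theorem torusGreen_zero_le_two_mul_log {L : ℕ} [NeZero L] (hev : Even L) (h4 : 4 ≤ L) :
    torusGreen (0 : TorusSite 2 L) ≤ 2 * Real.log L := by
  rw [torusGreen_zero_eq, div_eq_mul_one_div, mul_comm]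
  exact inv_sq_mul_sum_inv_dispersion_le hev h4

/-- **The Kennedy–Lieb–Shastry margin along the log-cold schedule `β_L = κ log L` in `d = 2`**
(the analytic endgame of the tree's `kls_thermal_margin`, one dimension down): with
`limsup R_L ≤ ρ < 1/√2` (`klsRiemannSum_eventually_le`, valid for `d ≥ 2`), the thermal term
`T_{2k}/(2β_{2k}) ≤ 2 log(2k)/(2κ log(2k)) = 1/κ` (`torusGreen_zero_le_two_mul_log`) and the
entropy term `log(n+1)/(4β_{2k}) ≤ ℓ/κ`, `ℓ = log(n+1)/4`: for
`κ ≥ κ₀ = 16ℓ + 1 + 4(ℓ + 1)/c`, `c = 2(s - ½√s ρ) > 0`, `s = ½S²`, every sequence `a_k ≤ 2S²`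
with, eventually, `a_k = 2g_k`, `e_k ≤ g_k + ½√e_k R_{2k} + T_{2k}/(2β_{2k})` and
`e_k ≥ s - log(n+1)/(2·2·β_{2k})` has `liminf a ≥ c/2 > 0`.
[cite: KLS1988PRL, Theorem and eqs. (7)–(8)] [cite: DysonLiebSimon1978, Thm. 5.1] -/
theorem kls_logCold_margin {n : ℕ} (hn : 1 ≤ n) :
    ∃ κ₀ : ℝ, 0 < κ₀ ∧ ∀ κ : ℝ, κ₀ ≤ κ → ∀ a : ℕ → ℝ,
      (∀ k, a k ≤ 2 * ((n : ℝ) / 2) ^ 2) →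
      (∀ᶠ k : ℕ in atTop, ∀ [NeZero (2 * k)], ∃ e g : ℝ, a k = 2 * g ∧
          e ≤ g + 1 / 2 * Real.sqrt e * klsRiemannSum 2 (2 * k) +
            1 / (2 * (κ * Real.log ((2 * k : ℕ) : ℝ))) * torusGreen (0 : TorusSite 2 (2 * k)) ∧
          ((n : ℝ) / 2) ^ 2 / 2 -
              Real.log ((n : ℝ) + 1) / (2 * ((2 : ℕ) : ℝ) * (κ * Real.log ((2 * k : ℕ) : ℝ))) ≤ e) →
      0 < liminf a atTop := by
  -- the eventual bound on the KLS Riemann sums (`d = 2` is allowed here)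
  obtain ⟨ρ, hρlt, hρev⟩ := klsRiemannSum_eventually_le 2 le_rfl
  set ρ' : ℝ := max ρ 0 with hρ'_def
  have hρ'0 : 0 ≤ ρ' := le_max_right _ _
  have hρ'lt : ρ' < Real.sqrt 2 / 2 := max_lt hρlt (by positivity)
  have hsqrt2 : Real.sqrt 2 < 2 := by
    rw [Real.sqrt_lt' (by norm_num)]; norm_num
  -- the spin constant `s = ½ S²` and its root
  set s : ℝ := ((n : ℝ) / 2) ^ 2 / 2 with hs_def
  have hn1 : (1 : ℝ) ≤ n := by exact_mod_cast hn
  have hs8 : 1 / 8 ≤ s := by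
    rw [hs_def]
    nlinarith
  have hs0 : 0 ≤ s := by linarith
  have hsq : Real.sqrt s = n * Real.sqrt 2 / 4 := by
    have h2 : s = (n * Real.sqrt 2 / 4) ^ 2 := by
      rw [hs_def, div_pow, div_pow, mul_pow, Real.sq_sqrt (by norm_num : (0 : ℝ) ≤ 2)]
      ring
    rw [h2, Real.sqrt_sq (by positivity)]
  have hss : Real.sqrt 2 / 4 ≤ Real.sqrt s := by
    rw [hsq]
    nlinarith [Real.sqrt_nonneg 2]
  -- the zero-temperature margin `c = 2(s - ½√s ρ') > 0`
  set c : ℝ := 2 * (s - 1 / 2 * Real.sqrt s * ρ') with hc_def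
  have hc : 0 < c := by
    have h1 : Real.sqrt s * Real.sqrt s = s := Real.mul_self_sqrt hs0
    have h3 : 0 < Real.sqrt s - ρ' / 2 := by linarith
    have h4 : s - 1 / 2 * Real.sqrt s * ρ' = Real.sqrt s * (Real.sqrt s - ρ' / 2) := by
      rw [mul_sub, h1]; ring
    rw [hc_def, h4]
    exact mul_pos two_pos (mul_pos (lt_of_lt_of_le (by positivity) hss) h3)
  -- the entropy constant and the threshold `κ₀`
  set ℓ : ℝ := Real.log ((n : ℝ) + 1) / 4 with hℓ_def
  have hℓ0 : 0 ≤ ℓ := by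
    rw [hℓ_def]
    exact div_nonneg (Real.log_nonneg (by linarith)) (by norm_num)
  set κ₀ : ℝ := 16 * ℓ + 1 + 4 * (ℓ + 1) / c with hκ₀_def
  have hκ₀pos : 0 < κ₀ := by rw [hκ₀_def]; positivity
  refine ⟨κ₀, hκ₀pos, fun κ hκ a hbd hev => ?_⟩
  have hκpos : 0 < κ := hκ₀pos.trans_le hκ
  have hκ16 : 16 * ℓ ≤ κ := by
    have : (0 : ℝ) ≤ 4 * (ℓ + 1) / c := by positivity
    linarith
  have hκc : 4 * (ℓ + 1) / c ≤ κ := by linarith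
  -- consequences: `ℓ/κ ≤ 1/16` and `ℓ/κ + 1/κ ≤ c/4`
  have hℓκ : ℓ / κ ≤ 1 / 16 := by
    rw [div_le_iff₀ hκpos]; linarith
  have hτκ : ℓ / κ + 1 / κ ≤ c / 4 := by
    rw [← add_div, div_le_iff₀ hκpos]
    rw [div_le_iff₀ hc] at hκc
    nlinarith
  -- eventually `R_{2k} ≤ ρ'`
  have h2k : Tendsto (fun k : ℕ => 2 * k) atTop atTop :=
    tendsto_atTop_atTop.2 fun b => ⟨b, fun k hk => by omega⟩
  have hRk : ∀ᶠ k : ℕ in atTop, klsRiemannSum 2 (2 * k) ≤ ρ' :=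
    (h2k.eventually hρev).mono fun k hk => hk.trans (le_max_left _ _)
  have hlog2 := Real.log_two_gt_d9
  -- eventually the sequence is `≥ c/2`
  have hev' : ∀ᶠ k : ℕ in atTop, c / 2 ≤ a k := by
    filter_upwards [hRk, hev, eventually_ge_atTop 2] with k hk hevk hk2
    haveI : NeZero (2 * k) := ⟨by omega⟩
    obtain ⟨e, g, hag, h7, hDk⟩ := hevk
    set R := klsRiemannSum 2 (2 * k) with hR_def
    set T := torusGreen (0 : TorusSite 2 (2 * k)) with hT_def
    have hR0 : 0 ≤ R := klsRiemannSum_nonneg _ _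
    have hT0 : 0 ≤ T := torusGreen_zero_nonneg (d := 2) (2 * k)
    -- the schedule: `β = κ log(2k) ≥ κ` since `log(2k) ≥ log 4 > 1`
    have hL4 : (4 : ℝ) ≤ ((2 * k : ℕ) : ℝ) := by exact_mod_cast (show 4 ≤ 2 * k by omega)
    have hlogL : 1 ≤ Real.log ((2 * k : ℕ) : ℝ) := by
      have h := Real.log_le_log (by norm_num) hL4
      have e4 : Real.log 4 = 2 * Real.log 2 := by
        rw [show (4 : ℝ) = 2 ^ 2 by norm_num, Real.log_pow]
        norm_num
      linarith
    have hTlog : T ≤ 2 * Real.log ((2 * k : ℕ) : ℝ) :=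
      torusGreen_zero_le_two_mul_log (even_two_mul k) (by omega)
    have hlogpos : 0 < Real.log ((2 * k : ℕ) : ℝ) := by linarith
    have hβκ : κ ≤ κ * Real.log ((2 * k : ℕ) : ℝ) := le_mul_of_one_le_right hκpos.le hlogL
    -- the thermal term: `T/(2β) ≤ 1/κ`
    have h2β : 0 < 2 * (κ * Real.log ((2 * k : ℕ) : ℝ)) := by
      have := mul_pos hκpos hlogpos
      linarith
    have hTβ : 1 / (2 * (κ * Real.log ((2 * k : ℕ) : ℝ))) * T ≤ 1 / κ := by
      rw [one_div_mul_eq_div, div_le_div_iff₀ h2β hκpos]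
      have := mul_le_mul_of_nonneg_right hTlog hκpos.le
      linarith
    -- from here on the inverse temperature is an abstract `β ≥ κ`
    generalize hβ_def : κ * Real.log ((2 * k : ℕ) : ℝ) = β at h7 hDk hβκ hTβ
    have hβpos : 0 < β := hκpos.trans_le hβκ
    -- (Dᵀ): `s - ℓ/β ≤ e`, and `ℓ/β ≤ ℓ/κ`
    have hsℓ : Real.log ((n : ℝ) + 1) / (2 * ((2 : ℕ) : ℝ) * β) = ℓ / β := by
      rw [hℓ_def, div_div]
      norm_num
    rw [hsℓ] at hDk
    have hℓβ : ℓ / β ≤ ℓ / κ := div_le_div_of_nonneg_left hℓ0 hκpos hβκ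
    have hℓβ0 : 0 ≤ ℓ / β := by positivity
    obtain ⟨sβ, hsβ_def⟩ : ∃ sβ : ℝ, sβ = s - ℓ / β := ⟨_, rfl⟩
    have hsβe : sβ ≤ e := by rw [hsβ_def, hs_def]; exact hDk
    have hsβ16 : 1 / 16 ≤ sβ := by rw [hsβ_def]; linarith
    have hsβ0 : 0 ≤ sβ := by linarith
    have hsβs : sβ ≤ s := by rw [hsβ_def]; linarith
    -- the monotone step on `t ↦ t - ½ R √t`
    have hR4 : R ≤ 4 * Real.sqrt sβ := by
      have h14 : (1 / 4 : ℝ) ≤ Real.sqrt sβ := by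
        rw [Real.le_sqrt (by norm_num) hsβ0]; linarith
      linarith
    have hmono := kls_monotone_step hsβ0 hsβe hR4
    -- `½ R √sβ ≤ ½ √s ρ'`
    have hRs : 1 / 2 * Real.sqrt sβ * R ≤ 1 / 2 * Real.sqrt s * ρ' :=
      mul_le_mul (mul_le_mul_of_nonneg_left (Real.sqrt_le_sqrt hsβs) (by norm_num)) hk hR0
        (by positivity)
    -- assemble (all linear from here)
    have key : sβ - 1 / 2 * Real.sqrt sβ * R - 1 / (2 * β) * T ≤ g := by
      linarith [h7, hmono]
    rw [hag]
    linarith [key, hRs, hTβ, hℓβ, hτκ, hsβ_def, hc_def]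
  exact (half_pos hc).trans_le (le_liminf_of_le (isCoboundedUnder_ge_of_le atTop hbd) hev')

/-- **`LogColdQuantumXYCalibration` holds** (route `LogColdTorus`, support item
`stmt-HubbardSuperconductivity-8811`): for every spin `S = n/2 ≥ 1/2` there is `κ₀ > 0` such that
for all `κ ≥ κ₀` the Gibbs states of the ferromagnetic quantum XY model `xyTorus 2 L n` at the
log-cold inverse temperature `β_L = κ log L` have long-range order along even tori,
`liminf_k (2k)⁻⁴ Σ_{x,y} Re⟨S¹_xS¹_y + S²_xS²_y⟩_{κ log(2k)} > 0`. Proof: the tree's PROVED thermal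
Kennedy–Lieb–Shastry chain (Gaussian domination `xy_infraredBound_thermal`, Kubo
`xy_kubo_thermal`, sum rule `sum_xy_structureFactor_mul_torusCosSum`, bond-energy bound
`xy_pairCorr_lower_thermal`, assembled by `kls_thermal_ineq7`, all valid for `d ≥ 1`) one
dimension down, the `d ≥ 3` finiteness of `T_L = torusGreen 0` being replaced by
`T_L ≤ 2 log L` and the schedule `β_L = κ log L` (`kls_logCold_margin`).
[cite: KLS1988PRL, Theorem, eqs. (3)–(8)] [cite: DysonLiebSimon1978, Thms. 4.2, 5.1] -/
theorem logColdQuantumXYCalibration_proof : LogColdQuantumXYCalibration := by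
  intro n hn
  obtain ⟨κ₀, hκ₀, hmar⟩ := kls_logCold_margin hn
  refine ⟨κ₀, hκ₀, fun κ hκ => ?_⟩
  have hκpos : 0 < κ := hκ₀.trans_le hκ
  have hlog2 := Real.log_two_gt_d9
  rw [hasEvenTorusLRO_iff]
  refine hmar κ hκ _ (fun k => ?_) ?_
  · -- boundedness of the LRO sequence, from (Tᵀ)
    refine div_le_of_le_mul₀ (by positivity) (by positivity) ?_
    have hb : ∀ x y : Site 2,
        torusPullback (fun L x y => xyCorrTorus (d := 2) (κ * Real.log L) L n x y) (2 * k) x y ≤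
          2 * ((n : ℝ) / 2) ^ 2 := by
      intro x y
      rw [torusPullback_apply]
      rcases Nat.eq_zero_or_pos k with rfl | hk
      · have h0 : xyCorrTorus (d := 2) (κ * Real.log ((2 * 0 : ℕ) : ℝ)) (2 * 0) n
            (Torus.proj (2 * 0) x) (Torus.proj (2 * 0) y) = 0 := by
          simp [xyCorrTorus]
        rw [h0]
        positivity
      · haveI : NeZero (2 * k) := ⟨by omega⟩
        rw [xyCorrTorus_eq_add]
        have h0 := le_of_abs_le (abs_re_gibbsState_xy_corr_le (κ * Real.log ((2 * k : ℕ) : ℝ))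
          (2 * k) n 0 (Torus.proj (2 * k) x) (Torus.proj (2 * k) y))
        have h1 := le_of_abs_le (abs_re_gibbsState_xy_corr_le (κ * Real.log ((2 * k : ℕ) : ℝ))
          (2 * k) n 1 (Torus.proj (2 * k) x) (Torus.proj (2 * k) y))
        linarith
    calc ∑ x ∈ halfOpenBox 2 (2 * k), ∑ y ∈ halfOpenBox 2 (2 * k),
          torusPullback (fun L x y => xyCorrTorus (d := 2) (κ * Real.log L) L n x y) (2 * k) x y
        ≤ ∑ x ∈ halfOpenBox 2 (2 * k), ∑ y ∈ halfOpenBox 2 (2 * k), 2 * ((n : ℝ) / 2) ^ 2 :=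
          sum_le_sum fun x _ => sum_le_sum fun y _ => hb x y
      _ = 2 * ((n : ℝ) / 2) ^ 2 * ((halfOpenBox 2 (2 * k)).card : ℝ) ^ 2 := by
          simp only [sum_const, nsmul_eq_mul]
          ring
  · -- eventually: the physics at side `L = 2k ≥ 4`, inverse temperature `β = κ log(2k)`
    filter_upwards [eventually_ge_atTop 2] with k hk2
    intro inst
    have hL4 : 4 ≤ 2 * k := by omega
    have hL3 : 3 ≤ 2 * k := by omega
    have hLe : Even (2 * k) := even_two_mul k
    have hd1 : 1 ≤ 2 := by norm_num
    have hdpos : 0 < 2 := by norm_num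
    have hd0 : (0 : ℝ) < ((2 : ℕ) : ℝ) := by norm_num
    have hLpos : (0 : ℝ) < ((2 * k : ℕ) : ℝ) ^ 2 :=
      pow_pos (by exact_mod_cast (show 0 < 2 * k by omega)) 2
    have hNpos : (0 : ℝ) < ((2 : ℕ) : ℝ) * ((2 * k : ℕ) : ℝ) ^ 2 := mul_pos hd0 hLpos
    -- the inverse temperature of the schedule is positive
    have hL4R : (4 : ℝ) ≤ ((2 * k : ℕ) : ℝ) := by exact_mod_cast hL4
    have hlogL : 1 ≤ Real.log ((2 * k : ℕ) : ℝ) := by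
      have h := Real.log_le_log (by norm_num) hL4R
      have e4 : Real.log 4 = 2 * Real.log 2 := by
        rw [show (4 : ℝ) = 2 ^ 2 by norm_num, Real.log_pow]
        norm_num
      linarith
    have hβpos : 0 < κ * Real.log ((2 * k : ℕ) : ℝ) := mul_pos hκpos (by linarith)
    -- the correlation kernel `G^α(x,y) = Re⟨S^α_xS^α_y⟩_β`, abstracted
    obtain ⟨G, hG⟩ : ∃ G : Fin 3 → TorusSite 2 (2 * k) → TorusSite 2 (2 * k) → ℝ,
        ∀ α x y, (gibbsState (κ * Real.log ((2 * k : ℕ) : ℝ)) (xyTorus 2 (2 * k) n)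
          (siteSpin n x α * siteSpin n y α)).re = G α x y := ⟨fun α x y => _, fun _ _ _ => rfl⟩
    -- the inputs (Aᵀ), (Bᵀ), (Cᵀ), (Dᵀ), (Sᵀ)
    have hA := fun q hq => xy_infraredBound_thermal (d := 2) (2 * k) hLe hL4 hdpos n hβpos q hq
    have hB := xy_kubo_thermal (d := 2) (2 * k) hLe hL4 n hβpos
    have hC := sum_xy_structureFactor_mul_torusCosSum (d := 2) (κ * Real.log ((2 * k : ℕ) : ℝ))
      (2 * k) n 0
    have hD := xy_pairCorr_lower_thermal hd1 (2 * k) hL3 n hβpos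
    have hS : ∀ x y, G 1 x y = G 0 x y := fun x y => by
      rw [← hG, ← hG, gibbsState_xy_corr_one_eq_zero]
    simp only [hG] at hA hB hC hD
    -- names for the pair sums and the structure factor
    set P0 : ℝ := ∑ x : TorusSite 2 (2 * k), ∑ i : Fin 2, G 0 x (x + Pi.single i 1) with hP0
    set P2 : ℝ := ∑ x : TorusSite 2 (2 * k), ∑ i : Fin 2, G 2 x (x + Pi.single i 1) with hP2
    set g : TorusSite 2 (2 * k) → ℝ := fun q =>
      (∑ x : TorusSite 2 (2 * k), ∑ y : TorusSite 2 (2 * k),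
        Real.cos (torusPhase (2 * k) q (x - y)) * G 0 x y) / ((2 * k : ℕ) : ℝ) ^ 2 with hg
    -- eq. (7) at positive temperature
    have h7 := kls_thermal_ineq7 hd1 (2 * k) hβpos g
      (e₁ := P0 / (((2 : ℕ) : ℝ) * ((2 * k : ℕ) : ℝ) ^ 2))
      (e₃ := P2 / (((2 : ℕ) : ℝ) * ((2 * k : ℕ) : ℝ) ^ 2))
      (fun q hq => hA q hq) ?_ ?_
    rotate_left
    · -- (Bᵀ) in averaged form
      rw [abs_div, abs_of_pos hNpos]
      exact div_le_div_of_nonneg_right hB hNpos.le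
    · -- (Cᵀ) in averaged form
      have h1 : ∑ q : TorusSite 2 (2 * k), g q * (torusCosSum (2 * k) q / ((2 : ℕ) : ℝ)) =
          (∑ q : TorusSite 2 (2 * k), (∑ x : TorusSite 2 (2 * k), ∑ y : TorusSite 2 (2 * k),
            Real.cos (torusPhase (2 * k) q (x - y)) * G 0 x y) * torusCosSum (2 * k) q) /
            (((2 * k : ℕ) : ℝ) ^ 2 * ((2 : ℕ) : ℝ)) := by
        rw [sum_div]
        refine sum_congr rfl fun q _ => ?_
        rw [hg, div_mul_div_comm]
      rw [h1, hC]
      field_simp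
    -- the LRO term is `2 |Λ|⁻¹ ĝ₀`
    refine ⟨P0 / (((2 : ℕ) : ℝ) * ((2 * k : ℕ) : ℝ) ^ 2), g 0 / ((2 * k : ℕ) : ℝ) ^ 2, ?_, h7, hD⟩
    rw [XYOrderProofs.sum_halfOpenBox_torusPullback, card_halfOpenBox, hg]
    simp only [xyCorrTorus_eq_add, hG, hS, ← two_mul, ← mul_sum, torusPhase_zero_left,
      Real.cos_zero, one_mul]
    push_cast
    field_simp

end LogCold

end Summit.HubbardSuperconductivity.HubbardSuperconductivity.Theorems.LogColdTorus
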